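import Summits.ValiantsHypothesis.ValiantsHypothesis.Theorems.LacunarySymmetroidMatrixDescartesPivotStaircaseAllK
import Summits.ValiantsHypothesis.ValiantsHypothesis.Theorems.LacunarySymmetroidMatrixDescartesPivotTwoDirectionsPosEnds

/-!
# `MatrixDescartes` (stmt-ValiantsHypothesis-18050) — the pole-weaving family WITHOUT the corner slack:
# a LONE FULL-RANK LETTER against `K − 1` parallel null letters has `Z₊ ≥ 2K − 1` for every `K`

HONEST FRAMING.  Cell `pub-symmetroid`, seat `val-sym-mdr-p2` (gen 25); helper file `--supports` the crux
`Theses.LacunarySymmetroid.MatrixDescartes` (OPEN), NO closure claim.  Currency: conjb-1's pivot column (`…CensusPivotDefs`: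
`pivotPosRoots`).  The POLE-WEAVING family of `…PivotStaircaseAllK` (gen 24) reaches `Z₊ ≥ 2K` at `(2, K)`, index one, with the
below letter `diag(1, 1/32)` and the above letters `diag(ε, 8nᵢ)`, `ε = 1/(512(c+1)²T) > 0`.  THIS FILE removes the corner slack:
with above letters `diag(0, 8nᵢ)` — NULL letters, all parallel to `e₂e₂ᵀ`, against the ONE full-rank letter `diag(1, 1/32)` — the
closed form is `g₁(t) = (1 − t)(1/32 + Σᵢ 8nᵢ t^{nᵢ}) − t² = g(t) + (1 − t)/32` (`g` the slack-free form of `…AllKCalculus`), and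

* `g₁_alternates`: `g₁` alternates in sign along the `2c + 2` points `1/16 < 1/2 < 1 − 1/(2n₀) < 1 − 1/(S n₀) < ⋯ < 1 − 1/(S n_{c−1})`
  (the first `2c + 2` weaving points `τ_j` of `…AllKSlack`; the right end point `R`, which needs `ε > 0`, is lost);
* **`le_pivotPosRoots_noSlack`: `Z₊ ≥ 2c + 1 = 2K − 1`** for the pencil `t·[[−1,1],[1,0]] + diag(1,1/32) + Σᵢ t^{nᵢ} diag(0, 8nᵢ)`
  (`K = c + 1` letters, every `c`), and the packaged object `exists_noSlack` (index one, diagonal PSD letters, letter `0` full rank,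
  letters `≥ 1` null and parallel).

* **EXACTNESS** (`pivotPosRoots_noSlack_eq`, `exists_loneFullRank_eq`): with the companion upper law `…PivotTwoDirectionsPosEnds`
  (`pivotPosRoots_le_of_lone_fullRank`: a lone full-rank letter against parallel null letters has `Z₊ ≤ 2K − 1`, every `K`, weak hard
  cell) the no-slack pencil has EXACTLY `2c + 1` positive roots, so this sub-row of the `(2,K)` index-one row is EXACTLY `2K − 1` for
  every `K ≥ 1` — the corner slack `ε > 0` of the `2K`-witnesses is necessary.  Nothing here bears on the `(2,K)` row itself (`[2K, 2K+2]`),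
on `MatrixDescartes` in its window, the upper pivot rungs, `DoorA26`/`DoorA34`, the registers, `VP ≠ VNP`.

[folklore] Intermediate value theorem via the tree's certificate kit (`Pivot.le_pivotPosRoots_of_certificate`) and the calculus of
`…PivotStaircaseAllKCalculus` / `…AllKSlack` (`g_odd_pos`, `bumps_half_le`, `bumps_valley_le`, `half_le_valley`, `frac_lt_eighth`,
`τ_succ_lt`, `τ_pos`).  No definitions (local notation only), no named facts.
-/

set_option linter.dupNamespace false

namespace Summit.ValiantsHypothesis.ValiantsHypothesis.Theorems.LacunarySymmetroidMatrixDescartes.Pivot.PoleWeave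

open scoped BigOperators Matrix
open Finset

/-! ### Notation (verbatim from `…PivotStaircaseAllKCalculus` / `…AllKSlack`; local, no definitions) -/

/-- The scale `S = 2^{c+7}`. -/
local notation3 (prettyPrint := false) "S⟦" c "⟧" => (2 ^ (c + 7))

/-- The exponents `nᵢ = (S²)^{i+1}`. -/
local notation3 (prettyPrint := false) "n⟦" c ", " i "⟧" => ((S⟦c⟧ * S⟦c⟧) ^ (i + 1))

/-- The top exponent `T = (S²)^c`. -/
local notation3 (prettyPrint := false) "T⟦" c "⟧" => ((S⟦c⟧ * S⟦c⟧) ^ c)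

/-- The slack-free closed form `g(t) = (1 − t)·Σᵢ 8nᵢ t^{nᵢ} − t²`. -/
local notation3 (prettyPrint := false) "g⟦" c "⟧(" t ")" =>
  ((1 - t) * (∑ i : Fin c, (8 * (n⟦c, (i : ℕ)⟧ : ℝ)) * t ^ (n⟦c, (i : ℕ)⟧)) - t ^ 2)

/-- The gaps `ω_j` of the interior weaving points (`ω₀ = 1/2`, `ω_{2i+1} = 1/(2nᵢ)`, `ω_{2i+2} = 1/(S nᵢ)`). -/
local notation3 (prettyPrint := false) "ω⟦" c ", " j "⟧" =>
  (if j = 0 then ((1 : ℝ) / 2)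
    else if j % 2 = 1 then (1 : ℝ) / (2 * (n⟦c, j / 2⟧ : ℝ))
    else (1 : ℝ) / ((S⟦c⟧ * n⟦c, j / 2 - 1⟧ : ℕ) : ℝ))

/-- The right end point `R = 1024 (c+1)² T` of `…AllKSlack` (only used through `τ`). -/
local notation3 (prettyPrint := false) "R⟦" c "⟧" => ((1024 : ℝ) * ((c : ℝ) + 1) ^ 2 * (T⟦c⟧ : ℝ))

/-- The weaving points: `τ₀ = 1/16`, `τ_{j+1} = 1 − ω_j` (`j ≤ 2c`), `τ_{2c+2} = R`. -/
local notation3 (prettyPrint := false) "τ⟦" c ", " j "⟧" =>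
  (if j = 0 then ((1 : ℝ) / 16) else if j = 2 * c + 2 then R⟦c⟧ else 1 - ω⟦c, j - 1⟧)

/-- The NO-SLACK closed form `g₁(t) = (1 − t)·(1/32 + Σᵢ 8nᵢ t^{nᵢ}) − t²`. -/
local notation3 (prettyPrint := false) "g₁⟦" c "⟧(" t ")" =>
  ((1 - t) * ((1 : ℝ) / 32 + ∑ i : Fin c, (8 * (n⟦c, (i : ℕ)⟧ : ℝ)) * t ^ (n⟦c, (i : ℕ)⟧)) - t ^ 2)

/-! ### 1. Signs of the no-slack closed form at the first `2c + 2` weaving points -/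

/-- `g₁ = g + (1 − t)/32`. -/
theorem g₁_eq (c : ℕ) (t : ℝ) : g₁⟦c⟧(t) = g⟦c⟧(t) + (1 - t) / 32 := by ring

/-- Left end: `g₁(1/16) > 0` (the factor `1 − t = 15/16` times `1/32` already beats `t² = 1/256`). -/
theorem g₁_left_pos (c : ℕ) : 0 < g₁⟦c⟧((1 : ℝ) / 16) := by
  have hsum : 0 ≤ ∑ i : Fin c, (8 * (n⟦c, (i : ℕ)⟧ : ℝ)) * ((1 : ℝ) / 16) ^ (n⟦c, (i : ℕ)⟧) :=
    Finset.sum_nonneg fun i _ => by positivity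
  nlinarith

/-- The valley `1/2`: `g₁(1/2) < 0`. -/
theorem g₁_half_neg (c : ℕ) : g₁⟦c⟧((1 : ℝ) / 2) < 0 := by
  have h1 := bumps_half_le c
  have h2 := frac_lt_eighth c
  nlinarith

/-- The valleys `1 − 1/(S n_b)`: `g₁ < 0` (bumps `≤ c/(8(c+1)) < 1/8`, `(1 − t)/32 ≤ 1/64`, `t² ≥ 1/4`). -/
theorem g₁_valley_neg (c b : ℕ) : g₁⟦c⟧(1 - 1 / ((S⟦c⟧ * n⟦c, b⟧ : ℕ) : ℝ)) < 0 := by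
  have h1 := bumps_valley_le c b
  have h2 := frac_lt_eighth c
  obtain ⟨h3, h4⟩ := half_le_valley c b
  have h5 : (1 : ℝ) / 4 ≤ (1 - 1 / ((S⟦c⟧ * n⟦c, b⟧ : ℕ) : ℝ)) ^ 2 := by nlinarith
  nlinarith

/-- Even interior points (valleys): `g₁(1 − ω_{2i}) < 0`. -/
theorem g₁_even_neg (c i : ℕ) : g₁⟦c⟧(1 - ω⟦c, 2 * i⟧) < 0 := by
  rcases i with _ | i
  · rw [show (2 * 0 : ℕ) = 0 from rfl, ω_zero, show (1 : ℝ) - 1 / 2 = 1 / 2 by norm_num]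
    exact g₁_half_neg c
  · rw [show 2 * (i + 1) = 2 * i + 2 by ring, ω_even]
    exact g₁_valley_neg c i

/-- Odd interior points (peaks): `g₁(1 − ω_{2i+1}) > 0` (`g > 0` there and `1 − t = ω ≥ 0`). -/
theorem g₁_odd_pos (c i : ℕ) (hi : i < c) : 0 < g₁⟦c⟧(1 - ω⟦c, 2 * i + 1⟧) := by
  have hg := g_odd_pos c i hi
  have hω : (0 : ℝ) ≤ ω⟦c, 2 * i + 1⟧ := by
    rw [ω_odd]
    have : (0 : ℝ) < (n⟦c, i⟧ : ℝ) := by exact_mod_cast one_le_n c i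
    positivity
  rw [g₁_eq]
  have : (0 : ℝ) ≤ (1 - (1 - ω⟦c, 2 * i + 1⟧)) / 32 := by linarith
  linarith

/-- Signs along the first `2c + 2` weaving points: `+` at even `j`, `−` at odd `j` (`j ≤ 2c + 1`). -/
theorem g₁_sign (c j : ℕ) (hj : j ≤ 2 * c + 1) :
    (j % 2 = 0 → 0 < g₁⟦c⟧(τ⟦c, j⟧)) ∧ (j % 2 = 1 → g₁⟦c⟧(τ⟦c, j⟧) < 0) := by
  rcases Nat.lt_or_ge j 1 with h0 | h1
  · have hj0 : j = 0 := by omega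
    subst hj0
    rw [τ_zero]
    exact ⟨fun _ => g₁_left_pos c, fun h => by norm_num at h⟩
  · rw [τ_mid c j h1 hj]
    obtain ⟨i, hi | hi⟩ := Nat.even_or_odd' (j - 1)
    · -- `j - 1 = 2i`: `j` odd, valley
      refine ⟨fun h => by omega, fun _ => ?_⟩
      rw [hi]; exact g₁_even_neg c i
    · -- `j - 1 = 2i + 1`: `j` even, peak with `i < c`
      refine ⟨fun _ => ?_, fun h => by omega⟩
      rw [hi]; exact g₁_odd_pos c i (by omega)

/-- Consecutive weaving points (among the first `2c + 2`) carry opposite signs of `g₁`. -/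
theorem g₁_alternates (c j : ℕ) (hj : j < 2 * c + 1) : g₁⟦c⟧(τ⟦c, j⟧) * g₁⟦c⟧(τ⟦c, j + 1⟧) < 0 := by
  obtain ⟨he, ho⟩ := g₁_sign c j (by omega)
  obtain ⟨he', ho'⟩ := g₁_sign c (j + 1) (by omega)
  rcases Nat.mod_two_eq_zero_or_one j with h | h
  · exact mul_neg_of_pos_of_neg (he h) (ho' (by omega))
  · exact mul_neg_of_neg_of_pos (ho h) (he' (by omega))

/-! ### 2. The no-slack pencil and its determinant -/

/-- The pivot letter `J = [[−1, 1], [1, 0]]` (local notation, as in `…AllK`). -/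
local notation3 (prettyPrint := false) "Jw" => (!![-1, 1; 1, 0] : Matrix (Fin 2) (Fin 2) ℝ)

/-- The `K = c + 1` PSD letters: the full-rank `diag(1, 1/32)` at exponent `0`, then the NULL letters `diag(0, 8nᵢ)` at `nᵢ`. -/
local notation3 (prettyPrint := false) "Pn⟦" c "⟧" =>
  (Fin.cons (Matrix.diagonal ![(1 : ℝ), 1 / 32])
    (fun i : Fin c => Matrix.diagonal ![(0 : ℝ), 8 * (n⟦c, (i : ℕ)⟧ : ℝ)]) :
      Fin (c + 1) → Matrix (Fin 2) (Fin 2) ℝ)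

/-- The exponents `(0, n₀, …, n_{c−1})`. -/
local notation3 (prettyPrint := false) "dw⟦" c "⟧" =>
  (Fin.cons 0 (fun i : Fin c => n⟦c, (i : ℕ)⟧) : Fin (c + 1) → ℕ)

/-- The index-one witness `w = (2, −1/2)ᵀ`. -/
local notation3 (prettyPrint := false) "Ww" =>
  (Matrix.of fun (i : Fin 2) (_ : Fin 1) => (![(2 : ℝ), -1 / 2] : Fin 2 → ℝ) i)

/-- **Closed form**: `det (t • J + diag(1, 1/32) + Σᵢ t^{nᵢ} diag(0, 8nᵢ)) = g₁(t)`. [folklore] -/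
theorem det_eq_noSlack (c : ℕ) (t : ℝ) : (t ^ 1 • Jw + ∑ k, t ^ (dw⟦c⟧ k) • Pn⟦c⟧ k).det = g₁⟦c⟧(t) := by
  rw [Fin.sum_univ_succ]
  simp only [Fin.cons_zero, Fin.cons_succ, pow_zero, one_smul, pow_one]
  rw [Matrix.det_fin_two]
  have h11 : (∑ i : Fin c, t ^ (n⟦c, (i : ℕ)⟧) • Matrix.diagonal ![(0 : ℝ), 8 * (n⟦c, (i : ℕ)⟧ : ℝ)]) 1 1
      = ∑ i : Fin c, (8 * (n⟦c, (i : ℕ)⟧ : ℝ)) * t ^ (n⟦c, (i : ℕ)⟧) := by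
    rw [Matrix.sum_apply]
    refine Finset.sum_congr rfl fun i _ => ?_
    simp [Matrix.smul_apply, mul_comm]
  have h00 : (∑ i : Fin c, t ^ (n⟦c, (i : ℕ)⟧) • Matrix.diagonal ![(0 : ℝ), 8 * (n⟦c, (i : ℕ)⟧ : ℝ)]) 0 0 = 0 := by
    rw [Matrix.sum_apply]; simp [Matrix.smul_apply]
  have h01 : (∑ i : Fin c, t ^ (n⟦c, (i : ℕ)⟧) • Matrix.diagonal ![(0 : ℝ), 8 * (n⟦c, (i : ℕ)⟧ : ℝ)]) 0 1 = 0 := by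
    rw [Matrix.sum_apply]; simp [Matrix.smul_apply]
  have h10 : (∑ i : Fin c, t ^ (n⟦c, (i : ℕ)⟧) • Matrix.diagonal ![(0 : ℝ), 8 * (n⟦c, (i : ℕ)⟧ : ℝ)]) 1 0 = 0 := by
    rw [Matrix.sum_apply]; simp [Matrix.smul_apply]
  simp only [Matrix.add_apply, Matrix.smul_apply]
  rw [h00, h01, h10, h11]
  simp
  ring

/-- The letters are positive semidefinite. -/
theorem posSemidef_Pn (c : ℕ) (k : Fin (c + 1)) : (Pn⟦c⟧ k).PosSemidef := by
  refine Fin.cases ?_ (fun i => ?_) k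
  · simp only [Fin.cons_zero]
    rw [Matrix.posSemidef_diagonal_iff]
    intro l; fin_cases l <;> simp
  · simp only [Fin.cons_succ]
    rw [Matrix.posSemidef_diagonal_iff]
    intro l
    fin_cases l
    · simp
    · have h8 : (0 : ℝ) ≤ 8 * (n⟦c, (i : ℕ)⟧ : ℝ) := by positivity
      simpa using h8

/-- The letters are DIAGONAL. -/
theorem diagonal_Pn (c : ℕ) (k : Fin (c + 1)) (a b : Fin 2) (hab : a ≠ b) : Pn⟦c⟧ k a b = 0 := by
  refine Fin.cases ?_ (fun i => ?_) k
  · simp only [Fin.cons_zero]; exact Matrix.diagonal_apply_ne _ hab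
  · simp only [Fin.cons_succ]; exact Matrix.diagonal_apply_ne _ hab

/-- Letter `0` is `1·e₁e₁ᵀ + (1/32)·e₂e₂ᵀ` (full rank), the letters `≥ 1` are `8nᵢ·e₂e₂ᵀ` (null, parallel). -/
theorem Pn_shape (c : ℕ) :
    Pn⟦c⟧ 0 = (1 : ℝ) • Matrix.vecMulVec ![(1 : ℝ), 0] ![(1 : ℝ), 0] + ((1 : ℝ) / 32) • Matrix.vecMulVec ![(0 : ℝ), 1] ![(0 : ℝ), 1]
    ∧ ∀ k : Fin (c + 1), k ≠ 0 → Pn⟦c⟧ k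
        = (Fin.cons (0 : ℝ) (fun i : Fin c => 8 * (n⟦c, (i : ℕ)⟧ : ℝ)) : Fin (c + 1) → ℝ) k
            • Matrix.vecMulVec ![(0 : ℝ), 1] ![(0 : ℝ), 1] := by
  constructor
  · simp only [Fin.cons_zero]
    ext a b; fin_cases a <;> fin_cases b <;> simp
  · intro k hk
    obtain ⟨i, rfl⟩ := Fin.eq_succ_of_ne_zero hk
    simp only [Fin.cons_succ]
    ext a b; fin_cases a <;> fin_cases b <;> simp

/-! ### 3. The count from below -/

/-- **`Z₊ ≥ 2c + 1 = 2K − 1`** for the no-slack pencil (`K = c + 1` letters, every `c`). -/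
theorem le_pivotPosRoots_noSlack (c : ℕ) : 2 * c + 1 ≤ pivotPosRoots 1 (dw⟦c⟧) Jw (Pn⟦c⟧) := by
  refine le_pivotPosRoots_of_certificate (det_eq_noSlack c) (fun j : Fin (2 * c + 1 + 1) => τ⟦c, (j : ℕ)⟧)
    (Fin.strictMono_iff_lt_succ.2 fun j => ?_) (fun j => τ_pos c j (by omega)) (fun j => ?_)
  · simp only [Fin.val_castSucc, Fin.val_succ]
    exact τ_succ_lt c j (by omega)
  · simp only [Fin.val_castSucc, Fin.val_succ]
    exact g₁_alternates c j j.isLt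

/-- **The no-slack object, packaged**: for every `c` a `2 × 2` pivot pencil with pivot exponent `1`, the symmetric index-one pivot
`[[−1,1],[1,0]]`, `c + 1` DIAGONAL PSD letters — letter `0` full rank at exponent `0 ≠ 1`, the others null and parallel to `e₂e₂ᵀ` —
and `≥ 2c + 1` distinct positive determinant roots. -/
theorem exists_noSlack (c : ℕ) :
    ∃ (d : Fin (c + 1) → ℕ) (P : Fin (c + 1) → Matrix (Fin 2) (Fin 2) ℝ) (γ : Fin (c + 1) → ℝ),
      (∀ k, (P k).PosSemidef) ∧ (∀ k i j, i ≠ j → P k i j = 0) ∧ d 0 ≠ 1 ∧ (∀ k, 0 ≤ γ k) ∧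
      P 0 = (1 : ℝ) • Matrix.vecMulVec ![(1 : ℝ), 0] ![(1 : ℝ), 0] + ((1 : ℝ) / 32) • Matrix.vecMulVec ![(0 : ℝ), 1] ![(0 : ℝ), 1] ∧
      (∀ k, k ≠ 0 → P k = γ k • Matrix.vecMulVec ![(0 : ℝ), 1] ![(0 : ℝ), 1]) ∧
      (Jw + Ww * Wwᵀ).PosSemidef ∧ 2 * c + 1 ≤ pivotPosRoots 1 d Jw P := by
  refine ⟨dw⟦c⟧, Pn⟦c⟧, Fin.cons (0 : ℝ) (fun i : Fin c => 8 * (n⟦c, (i : ℕ)⟧ : ℝ)), posSemidef_Pn c,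
    fun k i j hij => diagonal_Pn c k i j hij, ?_, ?_, (Pn_shape c).1, (Pn_shape c).2, indexOne_J, le_pivotPosRoots_noSlack c⟩
  · simp
  · intro k
    refine Fin.cases ?_ (fun i => ?_) k
    · simp
    · simp only [Fin.cons_succ]; positivity

/-! ### 4. Exactness: the sub-row «lone full-rank letter against parallel null letters» is `2K − 1` -/

/-- **EXACTLY `2c + 1`**: the no-slack pencil has `Z₊ = 2c + 1 = 2K − 1` (lower: the certificate above; upper: the positive-support
count with ends, `TwoDirections.PosEnds.pivotPosRoots_le_of_lone_fullRank`, for the shape «letter `0` = `e₁e₁ᵀ + (1/32)e₂e₂ᵀ`,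
letters `≥ 1` parallel to `e₂e₂ᵀ`», pivot `[[−1,1],[1,0]]`: `det = −1`, `m(J,e₁) = 0`, `m(J,e₂) = −1`). -/
theorem pivotPosRoots_noSlack_eq (c : ℕ) : pivotPosRoots 1 (dw⟦c⟧) Jw (Pn⟦c⟧) = 2 * c + 1 := by
  refine le_antisymm ?_ (le_pivotPosRoots_noSlack c)
  have h := TwoDirections.PosEnds.pivotPosRoots_le_of_lone_fullRank 1 (dw⟦c⟧) Jw ![(1 : ℝ), 0] ![(0 : ℝ), 1] 0 1 (1 / 32)
    (Fin.cons (0 : ℝ) (fun i : Fin c => 8 * (n⟦c, (i : ℕ)⟧ : ℝ))) (by norm_num) (by norm_num) (fun k => ?_) (Pn⟦c⟧)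
    (Pn_shape c).1 (Pn_shape c).2 (by simp) (by simp) (by simp [Matrix.det_fin_two]) (by simp) (by simp)
  · omega
  · refine Fin.cases ?_ (fun i => ?_) k
    · simp
    · simp only [Fin.cons_succ]; positivity

/-- **THE SUB-ROW IS ATTAINED FOR EVERY `K ≥ 1`**: at format `(2, K)`, pivot exponent `1`, index one, there is a pencil whose letter `0`
is the full-rank `1·e₁e₁ᵀ + (1/32)·e₂e₂ᵀ` at exponent `0 ≠ 1` and whose other letters are non-negative multiples of `e₂e₂ᵀ`, with EXACTLY
`2K − 1` distinct positive determinant roots (the upper side `Z₊ ≤ 2K − 1` holds for every pencil of this shape in the weak hard cell: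
`TwoDirections.PosEnds.pivotPosRoots_le_of_lone_fullRank`). -/
theorem exists_loneFullRank_eq (K : ℕ) (hK : 1 ≤ K) :
    ∃ (d : Fin K → ℕ) (J : Matrix (Fin 2) (Fin 2) ℝ) (P : Fin K → Matrix (Fin 2) (Fin 2) ℝ) (γ : Fin K → ℝ) (k₀ : Fin K),
      J.IsSymm ∧ (∃ W : Matrix (Fin 2) (Fin 1) ℝ, (J + W * Wᵀ).PosSemidef) ∧ (∀ k, (P k).PosSemidef) ∧ d k₀ ≠ 1 ∧ (∀ k, 0 ≤ γ k) ∧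
      P k₀ = (1 : ℝ) • Matrix.vecMulVec ![(1 : ℝ), 0] ![(1 : ℝ), 0] + ((1 : ℝ) / 32) • Matrix.vecMulVec ![(0 : ℝ), 1] ![(0 : ℝ), 1] ∧
      (∀ k, k ≠ k₀ → P k = γ k • Matrix.vecMulVec ![(0 : ℝ), 1] ![(0 : ℝ), 1]) ∧
      pivotPosRoots 1 d J P = 2 * K - 1 := by
  obtain ⟨c, rfl⟩ : ∃ c, K = c + 1 := ⟨K - 1, by omega⟩
  refine ⟨dw⟦c⟧, Jw, Pn⟦c⟧, Fin.cons (0 : ℝ) (fun i : Fin c => 8 * (n⟦c, (i : ℕ)⟧ : ℝ)), 0, isSymm_J, ⟨Ww, indexOne_J⟩,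
    posSemidef_Pn c, by simp, fun k => ?_, (Pn_shape c).1, (Pn_shape c).2, ?_⟩
  · refine Fin.cases ?_ (fun i => ?_) k
    · simp
    · simp only [Fin.cons_succ]; positivity
  · rw [pivotPosRoots_noSlack_eq]; omega

end Summit.ValiantsHypothesis.ValiantsHypothesis.Theorems.LacunarySymmetroidMatrixDescartes.Pivot.PoleWeave
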